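import Literature.AnabelianGeometry.SemiGraphs.UniversalCoveringOver
import Literature.AnabelianGeometry.SemiGraphs.OrbitGraphMap

/-!
# Functoriality of `𝒢_{∞,S}` in `S` ([SemiAnbd] §3 p. 38: "we may choose compatible maps")

Sequel to `UniversalCoveringOver.lean` and `OrbitGraphMap.lean`.  A morphism `f : T ⟶ S` of
`B^cov(𝒢)` induces `f̄ : 𝔾_T → 𝔾_S` (`orbitGraphMap`), hence a functor of fundamental groupoids,
and the morphism of coverings
`univCoverOverMap f c : 𝒢_{∞,T} (based at c) ⟶ 𝒢_{∞,S} (based at f̄ c)`,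
`(V, x, p) ↦ (f̄ V, f x, f̄_* p)`, lying over `f` — the "compatible maps `𝒢_{∞,j} → 𝒢_{∞,i}`"
of [SemiAnbd] p. 38.
-/

namespace Literature.AnabelianGeometry.SemiGraphs

namespace ProfiniteSemiGraph

open CategoryTheory

universe u

variable {𝒢 : ProfiniteSemiGraph.{u}} {T S : CovObj 𝒢} (f : T ⟶ S)
  (c : T.orbitGraph.CatCarrier) (h𝒢 : 𝒢.IsCountable)

/-- The image of a component of `𝔾_T` under `f̄ : 𝔾_T → 𝔾_S`. [cite: MochizukiSemiAnbd2006, Prop 3.6 p.38] -/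
noncomputable def CovObj.baseMap (x : T.orbitGraph.CatCarrier) : S.orbitGraph.CatCarrier :=
  (SemiGraph.Hom.catPrefunctor (CovObj.orbitGraphMap f)).obj x

/-- `f̄_*` on path classes: the functor of fundamental groupoids of `f̄ : 𝔾_T → 𝔾_S` on hom-sets.
[cite: MochizukiSemiAnbd2006, Prop 3.6 p.38] -/
noncomputable def CovObj.pathMap {x y : T.orbitGraph.CatCarrier}
    (p : T.orbitGraph.basept x ⟶ T.orbitGraph.basept y) :
    S.orbitGraph.basept (CovObj.baseMap f x) ⟶ S.orbitGraph.basept (CovObj.baseMap f y) :=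
  (SemiGraph.Hom.mapFundamentalGroupoid (CovObj.orbitGraphMap f)).map p

/-- `f̄_*` is compatible with composition. [cite: MochizukiSemiAnbd2006, Prop 3.6 p.38] -/
theorem CovObj.pathMap_comp {x y z : T.orbitGraph.CatCarrier}
    (p : T.orbitGraph.basept x ⟶ T.orbitGraph.basept y)
    (q : T.orbitGraph.basept y ⟶ T.orbitGraph.basept z) :
    CovObj.pathMap f (p ≫ q) = CovObj.pathMap f p ≫ CovObj.pathMap f q :=
  (SemiGraph.Hom.mapFundamentalGroupoid (CovObj.orbitGraphMap f)).map_comp p q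

/-- `f̄_*` preserves inverses. [cite: MochizukiSemiAnbd2006, Prop 3.6 p.38] -/
theorem CovObj.pathMap_inv {x y : T.orbitGraph.CatCarrier}
    (p : T.orbitGraph.basept x ⟶ T.orbitGraph.basept y) :
    CovObj.pathMap f (inv p) = inv (CovObj.pathMap f p) :=
  (SemiGraph.Hom.mapFundamentalGroupoid (CovObj.orbitGraphMap f)).map_inv p

/-- `f̄_*` maps the arrow of a branch of `𝔾_T` to the arrow of its image branch of `𝔾_S`.
[cite: MochizukiSemiAnbd2006, Prop 3.6 p.38] -/
theorem CovObj.pathMap_brArrow (bt : T.orbitGraph.Branch) (E : T.orbitGraph.Edge)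
    (V : T.orbitGraph.Vertex) (he : T.orbitGraph.edgeOf bt = E)
    (hv : T.orbitGraph.abuts bt = some V) :
    CovObj.pathMap f (T.orbitGraph.brArrow bt E V he hv) =
      S.orbitGraph.brArrow ((CovObj.orbitGraphMap f).branchMap bt) (CovObj.OEdge.map f E)
        (CovObj.OVertex.map f V) (by rw [(CovObj.orbitGraphMap f).edgeOf_branchMap, he]; rfl)
        ((CovObj.orbitGraphMap f).abuts_branchMap bt V hv) := by
  change 𝟙 _ ≫ _ = _
  exact Category.id_comp _

/-- The underlying map of `𝒢_{∞,T} → 𝒢_{∞,S}` on the fibre over a vertex: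
`(V, x, p) ↦ (f̄ V, f x, f̄_* p)`. [cite: MochizukiSemiAnbd2006, Prop 3.6 p.38] -/
noncomputable def CovObj.fibVMap (v : 𝒢.graph.Vertex) : T.FibV c v → S.FibV (CovObj.baseMap f c) v :=
  fun t => ⟨⟨CovObj.OVertex.map f t.1.1, (CovObj.OVertex.base_map f t.1.1).trans t.1.2⟩,
    ⟨⟨(f.fV v).hom.hom t.2.1.1, congrArg (CovObj.OVertex.map f) t.2.1.2⟩, CovObj.pathMap f t.2.2⟩⟩

/-- The underlying map on the fibre over an edge. [cite: MochizukiSemiAnbd2006, Prop 3.6 p.38] -/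
noncomputable def CovObj.fibEMap (e : 𝒢.graph.Edge) : T.FibE c e → S.FibE (CovObj.baseMap f c) e :=
  fun t => ⟨⟨CovObj.OEdge.map f t.1.1, (CovObj.OEdge.base_map f t.1.1).trans t.1.2⟩,
    ⟨⟨(f.fE e).hom.hom t.2.1.1, congrArg (CovObj.OEdge.map f) t.2.1.2⟩, CovObj.pathMap f t.2.2⟩⟩

/-- Compatibility of `fibEMap`/`fibVMap` with the gluings. [cite: MochizukiSemiAnbd2006, Prop 3.6 p.38] -/
theorem CovObj.glueOverFun_fibEMap (b : 𝒢.graph.Branch) (v : 𝒢.graph.Vertex)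
    (h : 𝒢.graph.abuts b = some v) (t : T.FibE c (𝒢.graph.edgeOf b)) :
    S.glueOverFun (CovObj.baseMap f c) b v h (CovObj.fibEMap f c _ t) =
      CovObj.fibVMap f c v (T.glueOverFun c b v h t) := by
  cases t with | mk E' yq =>
  cases yq with | mk yy q =>
  cases yy with | mk y hy =>
  cases E' with | mk E hE =>
  change Quot.mk _ _ = E at hy
  subst hy
  have hgl := CovHom.glue_fE f b v h y
  -- orbit components agree
  have hV : (Quot.mk _ ⟨v, (S.glue b v h).hom.hom.hom ((f.fE (𝒢.graph.edgeOf b)).hom.hom y)⟩ :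
      S.OVertex) = CovObj.OVertex.map f (Quot.mk _ ⟨v, (T.glue b v h).hom.hom.hom y⟩) := by
    change _ = Quot.mk _ (⟨v, (f.fV v).hom.hom ((T.glue b v h).hom.hom.hom y)⟩ : Σ v, (S.SV v).obj.V)
    rw [hgl]
  refine CovObj.FibV.ext S _ (Subtype.ext hV) hgl ?_
  -- paths: `f̄_* q ≫ b̃_S` versus `f̄_* (q ≫ b̃_T) = f̄_* q ≫ f̄_* b̃_T`
  change HEq (CovObj.pathMap f q ≫ S.brArrowOver b v h
      ⟨CovObj.OEdge.map f (Quot.mk _ ⟨𝒢.graph.edgeOf b, y⟩), (CovObj.OEdge.base_map f _).trans hE⟩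
      ((f.fE (𝒢.graph.edgeOf b)).hom.hom y) rfl)
    (CovObj.pathMap f (q ≫ T.brArrowOver b v h ⟨Quot.mk _ ⟨_, y⟩, hE⟩ y rfl))
  rw [CovObj.pathMap_comp, CovObj.brArrowOver, CovObj.brArrowOver, CovObj.pathMap_brArrow]
  -- both are `f̄_* q ≫ (arrow of the image branch)`, with propositionally equal targets
  have aux : ∀ (V₁ V₂ : S.OVertex) (e : V₁ = V₂) (bt : S.orbitGraph.Branch)
      (he₁ : S.orbitGraph.edgeOf bt = CovObj.OEdge.map f (Quot.mk _ ⟨𝒢.graph.edgeOf b, y⟩))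
      (h₁ : S.orbitGraph.abuts bt = some V₁) (h₂ : S.orbitGraph.abuts bt = some V₂),
      HEq (CovObj.pathMap f q ≫ S.orbitGraph.brArrow bt _ V₁ he₁ h₁)
        (CovObj.pathMap f q ≫ S.orbitGraph.brArrow bt _ V₂ he₁ h₂) := by
    intro V₁ V₂ e bt he₁ h₁ h₂
    subst e
    rfl
  exact aux _ _ hV _ rfl _ _

/-- **The morphism `𝒢_{∞,T} → 𝒢_{∞,S}` induced by `f : T ⟶ S`** ("compatible maps
`𝒢_{∞,j} → 𝒢_{∞,i}`", [SemiAnbd] p. 38). [cite: MochizukiSemiAnbd2006, Prop 3.6 p.38] -/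
noncomputable def CovObj.univCoverOverMap :
    T.univCoverOver c h𝒢 ⟶ S.univCoverOver (CovObj.baseMap f c) h𝒢 where
  fV v := ObjectProperty.homMk
    { hom := TypeCat.ofHom (CovObj.fibVMap f c v)
      comm := fun g => by
        apply ConcreteCategory.hom_ext
        intro t
        exact CovObj.FibV.ext S _ rfl (CovHom.fV_ρ f v g t.2.1.1) HEq.rfl }
  fE e := ObjectProperty.homMk
    { hom := TypeCat.ofHom (CovObj.fibEMap f c e)
      comm := fun g => by
        apply ConcreteCategory.hom_ext
        intro t
        exact CovObj.FibE.ext S _ rfl (CovHom.fE_ρ f e g t.2.1.1) HEq.rfl }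
  comm b v h := by
    apply ObjectProperty.hom_ext
    apply Action.Hom.ext
    apply ConcreteCategory.hom_ext
    intro t
    exact CovObj.glueOverFun_fibEMap f c b v h t

/-- `univCoverOverMap f` lies over `f`. [cite: MochizukiSemiAnbd2006, Prop 3.6 p.38] -/
theorem CovObj.univCoverOverMap_comp_proj :
    CovObj.univCoverOverMap f c h𝒢 ≫ S.univCoverOverProj _ h𝒢 = T.univCoverOverProj c h𝒢 ≫ f := by
  refine CovHom.ext (funext fun v => ?_) (funext fun e => ?_) <;> rfl

end ProfiniteSemiGraph

end Literature.AnabelianGeometry.SemiGraphs
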